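import Summits.Parity.GeneralizedHardyLittlewood.Theorems.PrimeLevelFamEdgeMomentsBeyondDiagonalDiagDecorPrimePowCross
import HarnessLib

/-!
# Route `PrimeLevelFamEdge`, crux K_A `MomentsBeyondDiagonal` (stmt-Parity-20007), line «petersson_layers» v4, stub `stub_diag`:
# **the cross term over an ABSTRACT inner decoration**: if `Σ_{k≤y}a_n(k)logᶜ(y/k)D(k) = −A·E_n·log^e y + O(D(n)(1+κ(n))(1+log y)^{e−1})`
# uniformly in the modulus `n`, then `Σ_p log^{m+1}p·a_n(p)·Σ_{k′}a_{np}(k′)logᶜ(y/(pk′))D(k′) = 2A·(m!e!/(e+m+1)!)·E_n·log^{e+m+1}y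
# + O(D(n)(1+κ(n))(1+log y)^{e+m})`

The peel-and-sum step of `…DiagDecorPrimePowCross` (inner `D = P_{i+1}`, `A = 2c(c−1)·i!(c−2)!/(c+i−1)!`, `e = c+i−1`) for an
arbitrary inner decoration `D` with a relative-precision-`1/log` engine (`A ≥ 0` not needed; `e` arbitrary): this makes every
multi-peel cross term of the higher central divisor-log moments mechanical — e.g. for `M₆ = τ(15P₂³ − 30P₂P₄ + 16P₆)` the
`P₂·P₂²` cross (inner `…DiagDecorPrimeSqSq`: `A = 8·c!/(c+2)!`, `e = c+2`) and the `P₂·P₄`, `P₄·P₂` crosses.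

* `abs_decorCross_term_sub_le` — the termwise bound;
* `abs_decorCross_sub_le` — **the displayed asymptotic**.

Def-free; theorems only. Helper `--supports stmt-Parity-20007`; closes nothing; K_A, K_B and the Parity summit are NOT proved;
nothing about Landau–Siegel zeros.

## References
* E. Kowalski, P. Michel, J. VanderKam, J. reine angew. Math. 526 (2000), (23)–(28) pp. 13–15 and Prop. 5.1 p. 18.
  [cite: KowalskiMichelVanderKam2000, (23)–(28) — derivation (prime-power-log decorations of the Selberg coordinates)]
* T. M. Apostol, *Introduction to Analytic Number Theory*, Springer 1976, Thm 4.9 (Mertens). [cite: Apostol1976, Thm 4.9 — derivation]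
-/

noncomputable section

open scoped Real
open Finset ArithmeticFunction

namespace Summit.Parity.GeneralizedHardyLittlewood.Theorems.MomentsBeyondDiagonal.DiagKernel

open Literature.NumberTheory.LFunctions Literature.NumberTheory.LFunctions.KMV2000
open SelbergCoord (kappa)
open Summit.Parity.GeneralizedHardyLittlewood.Theorems.BeyondDiagonalBeatsQuarter.KernelFormXSq
  (copTauW copTauW_apply copTauW_apply_prime mainConst divWeight divWeight_nonneg mainConst_nonneg mainConst_le_divWeight
    divWeight_prime_mul_le sum_prime_log_div_succ_le)

/-- Termwise bound for the abstract cross term: if `|Σ_{k≤y}a_n(k)logᶜ(y/k)D(k) + A·E_n·log^{e+1}y| ≤ C·D(n)(1+κ(n))(1+log y)^e`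
for all `n ≥ 1`, `y ≥ 1`, then for `p ≤ y`:
`|[p prime]·log^{m+1}p·a_n(p)·Σ_{k′}a_{np}(k′)logᶜ(y/(pk′))D(k′) − 2A·E_n·v(p)·log^m p·log^{e+1}(y/p)| ≤
[p prime, p∤n]·(log p/(p+1))·16C·D(n)(1+κ(n))(1+log y)^e log^m y`. [cite: KowalskiMichelVanderKam2000, (23)–(28) — derivation] -/
theorem abs_decorCross_term_sub_le (Dk : ℕ → ℝ) (m e : ℕ) {c : ℕ} {C : ℝ} (hC0 : 0 ≤ C) {A : ℝ}
    (hC : ∀ n : ℕ, n ≠ 0 → ∀ y : ℝ, 1 ≤ y →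
      |∑ k ∈ Icc 1 ⌊y⌋₊, copTauW n k * Real.log (y / k) ^ c * Dk k +
          A * mainConst n * Real.log y ^ (e + 1)| ≤
        C * divWeight n * (1 + kappa n) * (1 + Real.log y) ^ e)
    {n : ℕ} (hn : n ≠ 0) {y : ℝ} (hy : 1 ≤ y) {p : ℕ} (hp : p ∈ Icc 1 ⌊y⌋₊) :
    |(if p.Prime then Real.log p ^ (m + 1) * copTauW n p *
          ∑ k ∈ Icc 1 (⌊y⌋₊ / p), copTauW (n * p) k *
            (Real.log (y / ((p * k : ℕ) : ℝ)) ^ c * Dk k) else 0) -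
        (2 * A * mainConst n) *
          ((if p.Prime ∧ ¬ p ∣ n then Real.log p / ((p : ℝ) - 1) else 0) *
            (Real.log p ^ m * Real.log (y / p) ^ (e + 1)))| ≤
      if p.Prime ∧ ¬ p ∣ n then
        Real.log p / ((p : ℝ) + 1) *
          (16 * C * divWeight n * (1 + kappa n) * (1 + Real.log y) ^ e * Real.log y ^ m)
      else 0 := by
  obtain ⟨hp0, hpy, hyp1, hlp0, hlpy, hL0, hLy⟩ := prime_range_facts hy hp
  have hD := divWeight_nonneg n
  have hly : 0 ≤ Real.log y := Real.log_nonneg hy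
  have hκ : 0 ≤ kappa n := by
    unfold kappa
    exact Finset.sum_nonneg fun q hq ↦ by
      have hq2 : (2 : ℝ) ≤ q := by exact_mod_cast (Nat.prime_of_mem_primeFactors hq).two_le
      exact div_nonneg (Real.log_nonneg (by linarith)) (by linarith)
  by_cases hpr : p.Prime
  · by_cases hpn : p ∣ n
    · have h0 : copTauW n p = 0 := by rw [copTauW_apply_prime hpr, if_pos hpn]
      have hneg : ¬ (p.Prime ∧ ¬ p ∣ n) := fun h ↦ h.2 hpn
      rw [if_pos hpr, if_neg hneg, if_neg hneg, h0]
      simp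
    · have hpos : p.Prime ∧ ¬ p ∣ n := ⟨hpr, hpn⟩
      -- reindex the inner sum at scale `y/p`
      have hre : ∑ k ∈ Icc 1 (⌊y⌋₊ / p), copTauW (n * p) k *
            (Real.log (y / ((p * k : ℕ) : ℝ)) ^ c * Dk k) =
          ∑ k ∈ Icc 1 ⌊y / p⌋₊, copTauW (n * p) k * Real.log (y / p / k) ^ c * Dk k := by
        rw [← Nat.floor_div_natCast]
        refine Finset.sum_congr rfl fun k _ ↦ ?_
        rw [Nat.cast_mul, div_div]
        ring
      rw [if_pos hpr, if_pos hpos, if_pos hpos, copTauW_apply_prime hpr, if_neg hpn, hre]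
      have hnp : n * p ≠ 0 := mul_ne_zero hn hpr.ne_zero
      have hin := hC (n * p) hnp (y / p) hyp1
      set S := ∑ k ∈ Icc 1 ⌊y / p⌋₊, copTauW (n * p) k * Real.log (y / p / k) ^ c * Dk k with hS
      set err := S + A * mainConst (n * p) * Real.log (y / p) ^ (e + 1) with herr
      -- the size of the inner error
      have hDnp : divWeight (n * p) ≤ 2 * divWeight n := by
        rw [mul_comm]; exact divWeight_prime_mul_le hpr hn
      have hκnp : 1 + kappa (n * p) ≤ 2 * (1 + kappa n) := by
        have := kappa_mul_prime_le hn hpr; linarith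
      have hκnp0 : 0 ≤ 1 + kappa (n * p) := by
        have : 0 ≤ kappa (n * p) := by
          unfold kappa
          exact Finset.sum_nonneg fun q hq ↦ by
            have hq2 : (2 : ℝ) ≤ q := by exact_mod_cast (Nat.prime_of_mem_primeFactors hq).two_le
            exact div_nonneg (Real.log_nonneg (by linarith)) (by linarith)
        linarith
      have hpow : (1 + Real.log (y / p)) ^ e ≤ (1 + Real.log y) ^ e :=
        pow_le_pow_left₀ (by linarith) (by linarith) _
      have herr_le : |err| ≤ 4 * C * divWeight n * (1 + kappa n) * (1 + Real.log y) ^ e := by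
        calc |err| ≤ C * divWeight (n * p) * (1 + kappa (n * p)) * (1 + Real.log (y / p)) ^ e := hin
          _ ≤ C * (2 * divWeight n) * (2 * (1 + kappa n)) * (1 + Real.log y) ^ e := by
              gcongr
          _ = 4 * C * divWeight n * (1 + kappa n) * (1 + Real.log y) ^ e := by ring
      -- the main parts cancel by the prime weight transfer
      have hE := log_div_succ_mul_mainConst_mul hn hpr hpn
      have hp1 : (p : ℝ) + 1 ≠ 0 := by linarith
      have hSe : S = -A * mainConst (n * p) * Real.log (y / p) ^ (e + 1) + err := by
        rw [herr]; ring
      have hkey : Real.log p ^ (m + 1) * (-2 * ((p : ℝ) + 1)⁻¹) * S -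
          (2 * A * mainConst n) *
            (Real.log p / ((p : ℝ) - 1) * (Real.log p ^ m * Real.log (y / p) ^ (e + 1))) =
          Real.log p ^ (m + 1) * (-2 * ((p : ℝ) + 1)⁻¹) * err := by
        have hE' : mainConst n * (Real.log p / ((p : ℝ) - 1)) = Real.log p * ((p : ℝ) + 1)⁻¹ * mainConst (n * p) := by
          rw [← hE]; rw [div_eq_mul_inv]
        calc _ = Real.log p ^ (m + 1) * (-2 * ((p : ℝ) + 1)⁻¹) * S -
              2 * A * (mainConst n * (Real.log p / ((p : ℝ) - 1))) *
                (Real.log p ^ m * Real.log (y / p) ^ (e + 1)) := by ring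
          _ = _ := by rw [hE', hSe]; ring
      rw [hkey, abs_mul, abs_mul, abs_of_nonneg (pow_nonneg hlp0 (m + 1))]
      have habs2 : |(-2 : ℝ) * ((p : ℝ) + 1)⁻¹| = 2 * ((p : ℝ) + 1)⁻¹ := by
        rw [abs_mul, abs_inv, abs_of_pos (by linarith : (0 : ℝ) < (p : ℝ) + 1)]
        norm_num
      rw [habs2]
      have hpm : Real.log p ^ m ≤ Real.log y ^ m := pow_le_pow_left₀ hlp0 hlpy m
      calc Real.log p ^ (m + 1) * (2 * ((p : ℝ) + 1)⁻¹) * |err|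
          ≤ Real.log p ^ (m + 1) * (2 * ((p : ℝ) + 1)⁻¹) *
              (4 * C * divWeight n * (1 + kappa n) * (1 + Real.log y) ^ e) :=
            mul_le_mul_of_nonneg_left herr_le (by positivity)
        _ = Real.log p / ((p : ℝ) + 1) *
              (16 * C * divWeight n * (1 + kappa n) * (1 + Real.log y) ^ e * (Real.log p ^ m / 2)) := by
            rw [div_eq_mul_inv, pow_succ]; ring
        _ ≤ Real.log p / ((p : ℝ) + 1) *
              (16 * C * divWeight n * (1 + kappa n) * (1 + Real.log y) ^ e * Real.log y ^ m) := by
            have : Real.log p ^ m / 2 ≤ Real.log y ^ m := by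
              have h0 : 0 ≤ Real.log p ^ m := pow_nonneg hlp0 m
              linarith
            gcongr
  · have hneg : ¬ (p.Prime ∧ ¬ p ∣ n) := fun h ↦ hpr h.1
    rw [if_neg hpr, if_neg hneg, if_neg hneg]
    simp

/-- **The cross term over an abstract inner decoration** (see the module docstring): there is `C'` with, for all
`n ≥ 1`, `y ≥ 1`, `|Σ_{p≤y prime}log^{m+1}p·a_n(p)·Σ_{k′≤⌊y⌋/p}a_{np}(k′)logᶜ(y/(pk′))D(k′) − 2A·(m!(e+1)!/(e+1+m+1)!)·E_n·log^{e+1+m+1}y|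
≤ C'·D(n)(1+κ(n))(1+log y)^{e+1+m}`. [cite: KowalskiMichelVanderKam2000, (23)–(28) and Prop. 5.1 — derivation] -/
theorem abs_decorCross_sub_le (Dk : ℕ → ℝ) (m e : ℕ) {c : ℕ} {C : ℝ} (hC0 : 0 < C) {A : ℝ}
    (hC : ∀ n : ℕ, n ≠ 0 → ∀ y : ℝ, 1 ≤ y →
      |∑ k ∈ Icc 1 ⌊y⌋₊, copTauW n k * Real.log (y / k) ^ c * Dk k +
          A * mainConst n * Real.log y ^ (e + 1)| ≤
        C * divWeight n * (1 + kappa n) * (1 + Real.log y) ^ e) :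
    ∃ C' : ℝ, 0 < C' ∧ ∀ n : ℕ, n ≠ 0 → ∀ y : ℝ, 1 ≤ y →
      |∑ p ∈ (Icc 1 ⌊y⌋₊).filter Nat.Prime, Real.log p ^ (m + 1) * copTauW n p *
          ∑ k ∈ Icc 1 (⌊y⌋₊ / p), copTauW (n * p) k *
            (Real.log (y / ((p * k : ℕ) : ℝ)) ^ c * Dk k) -
          2 * A * ((m.factorial : ℝ) * (e + 1).factorial / (e + 1 + m + 1).factorial) *
            mainConst n * Real.log y ^ (e + 1 + m + 1)| ≤
        C' * divWeight n * (1 + kappa n) * (1 + Real.log y) ^ (e + 1 + m) := by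
  obtain ⟨C_E, hC_E, hE⟩ := mainConst_le_divWeight
  set q' : ℝ := (m.factorial : ℝ) * (e + 1).factorial / (e + 1 + m + 1).factorial with hq'
  have hq'0 : 0 ≤ q' := by positivity
  refine ⟨32 * C + 38 * 2 ^ m * |A| * C_E + 1, by positivity, fun n hn y hy ↦ ?_⟩
  have hy0 : 0 < y := by linarith
  have hly : 0 ≤ Real.log y := Real.log_nonneg hy
  have hκ : 0 ≤ kappa n := by
    unfold kappa
    exact Finset.sum_nonneg fun p hp ↦ by
      have hp2 : (2 : ℝ) ≤ p := by exact_mod_cast (Nat.prime_of_mem_primeFactors hp).two_le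
      exact div_nonneg (Real.log_nonneg (by linarith)) (by linarith)
  have hD := divWeight_nonneg n
  have hE0 := mainConst_nonneg n
  have hEn := hE n hn
  have hl4 : Real.log 4 ≤ 2 := by
    have := Real.log_two_lt_d9
    have h4 : Real.log 4 = 2 * Real.log 2 := by
      rw [show (4 : ℝ) = 2 ^ 2 by norm_num, Real.log_pow]; ring
    rw [h4]; linarith
  have hl40 : 0 ≤ Real.log 4 := Real.log_nonneg (by norm_num)
  set N := ⌊y⌋₊ with hN
  have hN1 : 1 ≤ N := by rw [hN]; exact Nat.one_le_floor_iff _ |>.2 hy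
  have hlogN : Real.log N ≤ Real.log y :=
    Real.log_le_log (by exact_mod_cast hN1) (Nat.floor_le hy0.le)
  have hlogN0 : 0 ≤ Real.log N := Real.log_natCast_nonneg N
  rw [Finset.sum_filter]
  obtain ⟨T, hT⟩ : ∃ T : ℕ → ℝ, ∀ p, T p = if p.Prime then Real.log p ^ (m + 1) * copTauW n p *
      ∑ k ∈ Icc 1 (N / p), copTauW (n * p) k *
        (Real.log (y / ((p * k : ℕ) : ℝ)) ^ c * Dk k) else 0 :=
    ⟨_, fun _ ↦ rfl⟩
  obtain ⟨v, hv⟩ : ∃ v : ℕ → ℝ, ∀ p, v p = if p.Prime ∧ ¬ p ∣ n then Real.log p / ((p : ℝ) - 1) else 0 :=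
    ⟨_, fun _ ↦ rfl⟩
  simp only [← hT]
  set K : ℝ := 16 * C * divWeight n * (1 + kappa n) * (1 + Real.log y) ^ e * Real.log y ^ m with hK
  have hK0 : 0 ≤ K := by positivity
  set k : ℝ := 2 * A * mainConst n with hk
  have hmain := abs_sum_primeWeight_coprime_logPow_mul_log_pow_sub_le hn hy m (e + 1)
  simp only [← hv] at hmain
  rw [← hq'] at hmain
  have hterm : ∀ p ∈ Icc 1 N, |T p - k * (v p * (Real.log p ^ m * Real.log (y / p) ^ (e + 1)))| ≤
      if p.Prime ∧ ¬ p ∣ n then Real.log p / ((p : ℝ) + 1) * K else 0 := by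
    intro p hp
    rw [hT p, hv p]
    exact abs_decorCross_term_sub_le Dk m e hC0.le hC hn hy hp
  have hsplit : ∑ p ∈ Icc 1 N, T p - 2 * A * q' * mainConst n * Real.log y ^ (e + 1 + m + 1) =
      ∑ p ∈ Icc 1 N, (T p - k * (v p * (Real.log p ^ m * Real.log (y / p) ^ (e + 1)))) +
        k * (∑ p ∈ Icc 1 N, v p * (Real.log p ^ m * Real.log (y / p) ^ (e + 1)) -
          q' * Real.log y ^ (e + 1 + m + 1)) := by
    rw [Finset.sum_sub_distrib, ← Finset.mul_sum, hk]
    ring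
  rw [hsplit]
  have hA : |∑ p ∈ Icc 1 N, (T p - k * (v p * (Real.log p ^ m * Real.log (y / p) ^ (e + 1))))| ≤
      K * (Real.log N + Real.log 4) := by
    calc _ ≤ ∑ p ∈ Icc 1 N, |T p - k * (v p * (Real.log p ^ m * Real.log (y / p) ^ (e + 1)))| :=
          Finset.abs_sum_le_sum_abs _ _
      _ ≤ ∑ p ∈ Icc 1 N, (if p.Prime ∧ ¬ p ∣ n then Real.log p / ((p : ℝ) + 1) * K else 0) :=
          Finset.sum_le_sum hterm
      _ ≤ K * (Real.log N + Real.log 4) := sum_prime_log_div_succ_le n N hK0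
  have hB : |k * (∑ p ∈ Icc 1 N, v p * (Real.log p ^ m * Real.log (y / p) ^ (e + 1)) -
      q' * Real.log y ^ (e + 1 + m + 1))| ≤
      2 * |A| * mainConst n * (2 ^ m * (19 + kappa n) * (1 + Real.log y) ^ (e + 1 + m)) := by
    rw [abs_mul]
    have hkabs : |k| = 2 * |A| * mainConst n := by
      rw [hk, abs_mul, abs_mul, abs_of_nonneg hE0]
      norm_num
    rw [hkabs]
    exact mul_le_mul_of_nonneg_left hmain (by positivity)
  have hX0 : 0 ≤ (1 + Real.log y) ^ (e + 1 + m) := by positivity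
  have hpow : (1 + Real.log y) ^ e * Real.log y ^ m * (Real.log N + Real.log 4) ≤
      2 * (1 + Real.log y) ^ (e + 1 + m) := by
    have eq : e + 1 + m = e + m + 1 := by omega
    have h1 : Real.log y ^ m ≤ (1 + Real.log y) ^ m := pow_le_pow_left₀ hly (by linarith) m
    have h2 : Real.log N + Real.log 4 ≤ 2 * (1 + Real.log y) := by linarith
    have hA : Real.log y ^ m * (Real.log N + Real.log 4) ≤ (1 + Real.log y) ^ m * (2 * (1 + Real.log y)) :=
      mul_le_mul h1 h2 (add_nonneg hlogN0 hl40) (by positivity)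
    calc (1 + Real.log y) ^ e * Real.log y ^ m * (Real.log N + Real.log 4)
        = (1 + Real.log y) ^ e * (Real.log y ^ m * (Real.log N + Real.log 4)) := by ring
      _ ≤ (1 + Real.log y) ^ e * ((1 + Real.log y) ^ m * (2 * (1 + Real.log y))) :=
          mul_le_mul_of_nonneg_left hA (by positivity)
      _ = 2 * (1 + Real.log y) ^ (e + 1 + m) := by rw [eq, pow_add, pow_succ]; ring
  have hfirst : K * (Real.log N + Real.log 4) ≤ 32 * C * divWeight n * (1 + kappa n) * (1 + Real.log y) ^ (e + 1 + m) := by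
    calc K * (Real.log N + Real.log 4)
        = 16 * C * divWeight n * (1 + kappa n) *
            ((1 + Real.log y) ^ e * Real.log y ^ m * (Real.log N + Real.log 4)) := by rw [hK]; ring
      _ ≤ 16 * C * divWeight n * (1 + kappa n) * (2 * (1 + Real.log y) ^ (e + 1 + m)) :=
          mul_le_mul_of_nonneg_left hpow (by positivity)
      _ = 32 * C * divWeight n * (1 + kappa n) * (1 + Real.log y) ^ (e + 1 + m) := by ring
  have hsecond : 2 * |A| * mainConst n * (2 ^ m * (19 + kappa n) * (1 + Real.log y) ^ (e + 1 + m)) ≤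
      38 * 2 ^ m * |A| * C_E * divWeight n * (1 + kappa n) * (1 + Real.log y) ^ (e + 1 + m) := by
    have j2 : mainConst n * (19 + kappa n) ≤ (C_E * divWeight n) * (19 * (1 + kappa n)) :=
      mul_le_mul hEn (by linarith) (by positivity) (by positivity)
    have hA0 : 0 ≤ |A| := abs_nonneg A
    calc 2 * |A| * mainConst n * (2 ^ m * (19 + kappa n) * (1 + Real.log y) ^ (e + 1 + m))
        = 2 * 2 ^ m * |A| * (mainConst n * (19 + kappa n)) * (1 + Real.log y) ^ (e + 1 + m) := by ring
      _ ≤ 2 * 2 ^ m * |A| * ((C_E * divWeight n) * (19 * (1 + kappa n))) * (1 + Real.log y) ^ (e + 1 + m) := by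
          apply mul_le_mul_of_nonneg_right _ hX0
          exact mul_le_mul_of_nonneg_left j2 (by positivity)
      _ = 38 * 2 ^ m * |A| * C_E * divWeight n * (1 + kappa n) * (1 + Real.log y) ^ (e + 1 + m) := by ring
  calc _ ≤ |∑ p ∈ Icc 1 N, (T p - k * (v p * (Real.log p ^ m * Real.log (y / p) ^ (e + 1))))| +
        |k * (∑ p ∈ Icc 1 N, v p * (Real.log p ^ m * Real.log (y / p) ^ (e + 1)) -
          q' * Real.log y ^ (e + 1 + m + 1))| := abs_add_le _ _
    _ ≤ K * (Real.log N + Real.log 4) +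
        2 * |A| * mainConst n * (2 ^ m * (19 + kappa n) * (1 + Real.log y) ^ (e + 1 + m)) := add_le_add hA hB
    _ ≤ 32 * C * divWeight n * (1 + kappa n) * (1 + Real.log y) ^ (e + 1 + m) +
        38 * 2 ^ m * |A| * C_E * divWeight n * (1 + kappa n) * (1 + Real.log y) ^ (e + 1 + m) :=
        add_le_add hfirst hsecond
    _ ≤ (32 * C + 38 * 2 ^ m * |A| * C_E + 1) * divWeight n * (1 + kappa n) * (1 + Real.log y) ^ (e + 1 + m) := by
        have : 0 ≤ divWeight n * (1 + kappa n) * (1 + Real.log y) ^ (e + 1 + m) := by positivity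
        nlinarith

end Summit.Parity.GeneralizedHardyLittlewood.Theorems.MomentsBeyondDiagonal.DiagKernel

end
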